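import Summits.QuantumFields.BalabanUV.Beta.GAN24.WilsonFaceCurrentProfile
import Summits.QuantumFields.BalabanUV.Beta.GAN24.StepCovarianceCellPairingTentZero
import Summits.QuantumFields.BalabanUV.Beta.GAN24.DeepProfileContourSum

/-!
# `BalabanUV.Beta.GAN24.FaceWordEEValueZero` — binder row G-an2-4 ∕ (CONV-C), W-slot (α-0), typer's PART VI row **T6-VAL** (the VALUES of the E-frame forcing's crossed face reads),
# the (γ) hand's letter **K7-0** (memo `HOME/b2b-balaban-gan24-formalise-leaf-06/g55/HX-VALUES-g55.md` §6; leaf-03 g72 `CrossedLedgerClosure`'s remainder `R m`):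
# **THE E⊗E FACE WORD OF THE LEVEL-`0` FORCING AT THE DEEP PERIOD `Lc·N`, VALUED — IT HAS g56's LEVEL-`(j+1)` SHAPE WITH `j + 1 ↦ 0`**:
# `Σ_{x∈box(Lc·N)} Σ_a FF^{(Lc·N)}_L(a,x)·(X̃♮_0 FF^{(Lc·N)}_R)(a,x) = −¼·sf²·( wVH_0⁻¹·⟨q^{(Lc·N)}_{μα}, E2_0 q^{(Lc·N)}_{νβ}⟩_{box(Lc·N)} − wVH_0⁻¹·Lc^{2(d+1)}·⟨q^{(N)}_{μα}, E2_1 q^{(N)}_{νβ}⟩_{box N} )`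
# (`μ ≠ α`, `ν ≠ β`; in-block root, every `d`, `Lc ≥ 1`, every `N ≥ 1`), `FF^{(M)}_R(b,z) = Σ'_w [w_β % M = M−1]·Σ'_t [t_ν % M = M−1]·wilsonA d ν t (z,w)_{bβ}`,
# `FF^{(M)}_L(a,x) = Σ'_y [y_α % M = M−1]·Σ'_t [t_μ % M = M−1]·wilsonA d μ t (y,x)_{αa}` the period-`M` two-face currents of the Wilson cubic table, `E2_0 = d*d`, `E2_1 = wΦ_{Lc}`, `wVH_0 = 1`
# — so `CrossedLedgerTelescope`'s `hface0` IS `hface` at `k + 1 ↦ 0` with the SAME `ρ = Lc^{2(d+1)}`, and the «Wilson remainder» `R` is `V(0, ·) = ⟨q, d*d q⟩`, a RATIONAL cell sum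
# (G-an2-4 CRUX TEAM (2), seat `b2b-balaban-gan24-formalise-leaf-06` = the (γ) hand, gen 57; journal [GAN24LEAF06-G57-INTENT-1])

NOT IN PRINT; OUR BOOKKEEPING ([folklore] the TEXT of this lineage's g56 `FaceWordEEValueDeep.cellPairing_deep_value(_units)` with `j + 1 ↦ 0`, BY NAME over this seat's
`WilsonFaceCurrentProfile.faceface_wilsonA_eq_E2zero(_fst)` (the Wilson face currents are `E2_0`-images of K2's profile — the level-`0` K1b∕K2), `StepCovarianceCellPairingTentZero.
sum_box_E2T_mul_dressedStep_E2_apply_bridge_zero` (K5 at level `0`) and this lineage's K3 `DeepProfileContourSum.contourSum_deepProfile` ✓ (`𝒬 q^{(Lc·N)} = Lc^{d+1}·q^{(N)}`);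
0 `def`, 0 cited fact, 0 `def … : Prop`, 0 sorry).
HONEST FRAMING (cell contract, verbatim): «discharging `BetaPertH` makes Bałaban's UV stability UNCONDITIONAL — a real constructive-QFT result; it is NOT the continuum
limit and NOT the Clay problem.»  HONEST DEPENDENCY (verbatim): «continuum YM on T⁴ ⇐ BetaPertH ∧ nine spine estimates (0/9 proved); BetaPertH ⇐ (D1) ∧ (D4) ∧ CAP+tail;
G-an2-4 gates asym, D1 and NE2/3/4.»

WHY.  leaf-03's crossed ledger (`CrossedLedgerUnrolled` ∕ `Telescope` ∕ `Closure` ✓) reduces row T6-VAL, GRANTED the depth-tower shapes, to one number per period for the level-`0`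
forcing's face reads (`c 0·R m`); the shapes at levels `≥ 1` are g56's K7-a files; THIS FILE is the level-`0` shape for the E⊗E sector, and it turns out to be the SAME shape: the first
term is the Wilson pairing `⟨q^{(M)}_{μα}, d*d q^{(M)}_{νβ}⟩_{box M} = ⟨curv q, curv q⟩_{box M}` (RATIONAL: `curv q^{(M)}_{νβ} = χ_ν⊗χ_β − M⁻²·e_ν∧e_β`, this seat's `WilsonFaceCurrentProfile.
curv_qProfileM`), the second the SAME pairing one level up, against `E2_1 = wΦ_{Lc}`, with `ρ = Lc^{2(d+1)}`.  ENGINE (weight 0; this lineage's g56 `level0.py`, kit j222767, D = 2, Lc = 3):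
word `= R − T` EXACTLY per `N`-cell, `R(N) = −½(1 − N⁻²)` (N = 3, 9, 27), `T(N) = (3⁴∕4)·V(1, N∕3)`.

WHAT ([folklore]; generic `d`, in-block root `toSite r`, `Lc, N ≥ 1` via `NeZero`, units `sf sm`, E-amplitude `cE`):
* §1 **`cellPairing_zero_value`** — the display above for the RAW Wilson table `wilsonA d`;
* §2 `unitS_smul_wilsonA_inl_inl`, `faceface_unitS_smul_wilsonA`, **`cellPairing_zero_value_units`** — the same for road-P2's unit-scaled level-`0` E-sector table
  `unitS sf sm (cE • wilsonA d)` (factor `((sf·sm)⁻¹sf⁻²cE)²`; at the literal `sf = sfStep Lc 0 = 1`, `sm = smStep d Lc 0 = 1`).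
Asserts NO value of Bałaban's tables beyond this identity; the E⊗VH ∕ VH⊗E ∕ VH⊗VH face words (zero by this lineage's `FaceDataVHNull`, p382934), the multiplier ∕ W words, the
swapped word and the `LS`-assembly into road-P2's `FFsym` literal are NOT here; discharges NOTHING of `hX` ∕ `hXu` ∕ (C)_{≥1} ∕ `hB0` ∕ `hBF` ∕ (Q-L); NEVER «G-an2-4 closed» as
(CONV-C); NOT D1, NOT `BetaPertH`, NOT continuum, NOT Clay.  2026-08-24; no existing file touched.
-/

noncomputable section

open Finset
open scoped BigOperators
open Literature.MathematicalPhysics.QuantumFieldTheory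
open Literature.MathematicalPhysics.QuantumFieldTheory.Balaban1983to89
open Literature.MathematicalPhysics.QuantumFieldTheory.Balaban1983to89.Beta
open ExpKernelCalculus (Site MKer)
open AffineAveraging (box toSite contourSum)
open OneStepResolventKernel (Fib)
open OneStepKernelFamily (KInvStep)
open StepJetData (wilsonA)
open BalabanStepJetsSucc (E2 wVH)
open Summit.QuantumFields.BalabanUV.Beta.AxialDressingRooted (coDressKBmAt one_le_of_neZero)
open Summit.QuantumFields.BalabanUV.Beta.HessKerDressedUnits (unitK unitS unitS_apply legScale_inl)
open Summit.QuantumFields.BalabanUV.Beta.GAN24.WilsonFaceCurrentProfile (faceface_wilsonA_eq_E2zero faceface_wilsonA_eq_E2zero_fst qProfileM_periodic'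
  abs_qProfileM_le_two)
open Summit.QuantumFields.BalabanUV.Beta.GAN24.StepCovarianceCellPairingTentZero (sum_box_E2T_mul_dressedStep_E2_apply_bridge_zero)
open Summit.QuantumFields.BalabanUV.Beta.GAN24.DeepProfileContourSum (contourSum_deepProfile)

namespace Summit.QuantumFields.BalabanUV.Beta.GAN24.FaceWordEEValueZero

variable {d : ℕ} {Lc : ℕ} [NeZero Lc] {r : Fin (d + 1) → ℕ}

/-! ## §1 The E⊗E face word of the level-`0` forcing at the deep period, valued (raw Wilson table) -/

/-- [folklore] **K3 FOR K2's SPELLING AT LEVEL `0`**: the `Lc`-block contour sums of the period-`(Lc·N)` profile are `Lc^{d+1}` times the period-`N` profile (`ν ≠ β`, `N ≥ 1`)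
— `DeepProfileContourSum.contourSum_deepProfile` with the natural-number product cast `((Lc·N : ℕ) : ℝ) = Lc·N`. -/
theorem contourSum_qProfile_mul {N : ℕ} (hN : 1 ≤ N) {ν β : Fin (d + 1)} (hνβ : ν ≠ β) (κ : Fin (d + 1)) (y : Site (d + 1)) :
    contourSum Lc (fun (b' : Fin (d + 1)) (s : Site (d + 1)) =>
      ((if b' = ν then ((((Lc * N : ℕ) : ℝ))⁻¹ * (((Lc * N : ℕ) : ℝ))⁻¹) * ((((s β % ((Lc * N : ℕ) : ℤ) : ℤ) : ℝ) - ((((Lc * N : ℕ) : ℝ)) - 1) / 2)) else 0)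
        + (if b' = β then (-(((Lc * N : ℕ) : ℝ))⁻¹ * ((((s ν % ((Lc * N : ℕ) : ℤ) : ℤ) : ℝ) - ((((Lc * N : ℕ) : ℝ)) - 1) / 2))) *
            (if s β % ((Lc * N : ℕ) : ℤ) = ((Lc * N : ℕ) : ℤ) - 1 then (1 : ℝ) else 0) else 0))) κ y =
      (Lc : ℝ) ^ (d + 1) *
        ((if κ = ν then (((N : ℝ))⁻¹ * ((N : ℝ))⁻¹) * ((((y β % (N : ℤ) : ℤ) : ℝ) - (((N : ℝ)) - 1) / 2)) else 0)
        + (if κ = β then (-((N : ℝ))⁻¹ * ((((y ν % (N : ℤ) : ℤ) : ℝ) - (((N : ℝ)) - 1) / 2))) *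
            (if y β % (N : ℤ) = (N : ℤ) - 1 then (1 : ℝ) else 0) else 0)) := by
  have e : (fun (b' : Fin (d + 1)) (s : Site (d + 1)) =>
      ((if b' = ν then ((((Lc * N : ℕ) : ℝ))⁻¹ * (((Lc * N : ℕ) : ℝ))⁻¹) * ((((s β % ((Lc * N : ℕ) : ℤ) : ℤ) : ℝ) - ((((Lc * N : ℕ) : ℝ)) - 1) / 2)) else 0)
        + (if b' = β then (-(((Lc * N : ℕ) : ℝ))⁻¹ * ((((s ν % ((Lc * N : ℕ) : ℤ) : ℤ) : ℝ) - ((((Lc * N : ℕ) : ℝ)) - 1) / 2))) *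
            (if s β % ((Lc * N : ℕ) : ℤ) = ((Lc * N : ℕ) : ℤ) - 1 then (1 : ℝ) else 0) else 0))) =
      (fun (b' : Fin (d + 1)) (s : Site (d + 1)) =>
        (if b' = ν then (((Lc : ℝ) * (N : ℝ))⁻¹ * ((Lc : ℝ) * (N : ℝ))⁻¹) *
            ((((s β % ((Lc : ℤ) * (N : ℤ)) : ℤ) : ℝ) - (((Lc : ℝ) * (N : ℝ)) - 1) / 2)) else 0)
          + (if b' = β then (-((Lc : ℝ) * (N : ℝ))⁻¹ * ((((s ν % ((Lc : ℤ) * (N : ℤ)) : ℤ) : ℝ) - (((Lc : ℝ) * (N : ℝ)) - 1) / 2))) *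
            (if s β % ((Lc : ℤ) * (N : ℤ)) = (Lc : ℤ) * (N : ℤ) - 1 then (1 : ℝ) else 0) else 0)) := by
    funext b' s
    simp only [Nat.cast_mul]
  rw [e]
  exact contourSum_deepProfile (Lc := Lc) hN hνβ κ y

/-- NOT IN PRINT; OUR BOOKKEEPING.  **THE E⊗E FACE WORD OF THE LEVEL-`0` FORCING AT PERIOD `Lc·N`, IN CELL-PAIRING FORM, VALUED** (`μ ≠ α`, `ν ≠ β`; in-block root, every `d`,
`Lc, N ≥ 1`): with `X̃♮_0 = unitK sf sm G_0`, `M = Lc·N` and the period-`M` two-face currents `FF_L(a,x) = Σ'_y χ_M(y_α)·Σ'_t χ_M(t_μ)·wilsonA d μ t (y,x)_{αa}`,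
`FF_R(b,z) = Σ'_w χ_M(w_β)·Σ'_t χ_M(t_ν)·wilsonA d ν t (z,w)_{bβ}`,
`Σ_{x∈box M} Σ_a FF_L(a,x)·Σ'_z Σ_b X̃♮_0(x,z)_{ab}·FF_R(b,z) = (−½)·½·sf²·( wVH_0⁻¹·⟨q^{(M)}_{μα}, E2_0 q^{(M)}_{νβ}⟩_{box M} − wVH_0⁻¹·Lc^{2(d+1)}·⟨q^{(N)}_{μα}, E2_1 q^{(N)}_{νβ}⟩_{box N} )`. -/
theorem cellPairing_zero_value (hr : r ∈ box (d + 1) Lc) (sf sm : ℝ) (N : ℕ) [NeZero N] {μ α ν β : Fin (d + 1)} (hμα : μ ≠ α) (hνβ : ν ≠ β) :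
    ∑ x ∈ box (d + 1) (Lc * N), ∑ a : Fin (d + 1),
        (∑' y : Site (d + 1), (if y α % ((Lc * N : ℕ) : ℤ) = ((Lc * N : ℕ) : ℤ) - 1 then (1 : ℝ) else 0) *
          ∑' t : Site (d + 1), (if t μ % ((Lc * N : ℕ) : ℤ) = ((Lc * N : ℕ) : ℤ) - 1 then
            wilsonA d μ t y (toSite x) (Sum.inl α) (Sum.inl a)
            else 0)) *
        (∑' z : Site (d + 1), ∑ b : Fin (d + 1), unitK sf sm (coDressKBmAt (toSite r) Lc (KInvStep (d := d) Lc 0)) (toSite x) z (Sum.inl a) (Sum.inl b) *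
          (∑' w : Site (d + 1), (if w β % ((Lc * N : ℕ) : ℤ) = ((Lc * N : ℕ) : ℤ) - 1 then (1 : ℝ) else 0) *
            ∑' t : Site (d + 1), (if t ν % ((Lc * N : ℕ) : ℤ) = ((Lc * N : ℕ) : ℤ) - 1 then
              wilsonA d ν t z w (Sum.inl b) (Sum.inl β)
              else 0))) =
      (-(1 / 2 : ℝ)) * (1 / 2 : ℝ) * ((sf * sf) *
        ((wVH d Lc 0)⁻¹ *
            ∑ x ∈ box (d + 1) (Lc * N), ∑ b : Fin (d + 1),
              ((if b = μ then ((((Lc * N : ℕ) : ℝ))⁻¹ * (((Lc * N : ℕ) : ℝ))⁻¹) * ((((toSite x α % ((Lc * N : ℕ) : ℤ) : ℤ) : ℝ) - ((((Lc * N : ℕ) : ℝ)) - 1) / 2)) else 0)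
                + (if b = α then (-(((Lc * N : ℕ) : ℝ))⁻¹ * ((((toSite x μ % ((Lc * N : ℕ) : ℤ) : ℤ) : ℝ) - ((((Lc * N : ℕ) : ℝ)) - 1) / 2))) *
                    (if toSite x α % ((Lc * N : ℕ) : ℤ) = ((Lc * N : ℕ) : ℤ) - 1 then (1 : ℝ) else 0) else 0)) *
              ∑' s : Site (d + 1), ∑ b' : Fin (d + 1), E2 d Lc 0 (toSite x) s (Sum.inl b) (Sum.inl b') *
                ((if b' = ν then ((((Lc * N : ℕ) : ℝ))⁻¹ * (((Lc * N : ℕ) : ℝ))⁻¹) * ((((s β % ((Lc * N : ℕ) : ℤ) : ℤ) : ℝ) - ((((Lc * N : ℕ) : ℝ)) - 1) / 2)) else 0)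
                  + (if b' = β then (-(((Lc * N : ℕ) : ℝ))⁻¹ * ((((s ν % ((Lc * N : ℕ) : ℤ) : ℤ) : ℝ) - ((((Lc * N : ℕ) : ℝ)) - 1) / 2))) *
                      (if s β % ((Lc * N : ℕ) : ℤ) = ((Lc * N : ℕ) : ℤ) - 1 then (1 : ℝ) else 0) else 0)) -
          (wVH d Lc 0)⁻¹ * (((Lc : ℝ) ^ (d + 1) * (Lc : ℝ) ^ (d + 1)) *
            ∑ y ∈ box (d + 1) N, ∑ a : Fin (d + 1),
              ((if a = μ then (((N : ℝ))⁻¹ * ((N : ℝ))⁻¹) * ((((toSite y α % (N : ℤ)) : ℤ) : ℝ) - ((N : ℝ) - 1) / 2) else 0)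
                + (if a = α then (-((N : ℝ))⁻¹ * ((((toSite y μ % (N : ℤ)) : ℤ) : ℝ) - ((N : ℝ) - 1) / 2)) *
                    (if toSite y α % (N : ℤ) = (N : ℤ) - 1 then (1 : ℝ) else 0) else 0)) *
              ∑' s : Site (d + 1), ∑ b' : Fin (d + 1), E2 d Lc 1 (toSite y) s (Sum.inl a) (Sum.inl b') *
                ((if b' = ν then (((N : ℝ))⁻¹ * ((N : ℝ))⁻¹) * ((((s β % (N : ℤ)) : ℤ) : ℝ) - ((N : ℝ) - 1) / 2) else 0)
                  + (if b' = β then (-((N : ℝ))⁻¹ * ((((s ν % (N : ℤ)) : ℤ) : ℝ) - ((N : ℝ) - 1) / 2)) *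
                      (if s β % (N : ℤ) = (N : ℤ) - 1 then (1 : ℝ) else 0) else 0))))) := by
  have hLc : 1 ≤ Lc := one_le_of_neZero Lc
  have hN : 1 ≤ N := one_le_of_neZero N
  have hM : 1 ≤ Lc * N := Nat.mul_pos hLc hN
  -- K5 at level 0 on the two period-`(Lc·N)` pre-images, with K3's proportional block contour sums
  have hval := sum_box_E2T_mul_dressedStep_E2_apply_bridge_zero hr sf sm N ((Lc : ℝ) ^ (d + 1))
    (qL := fun b (y : Site (d + 1)) =>
      ((if b = μ then ((((Lc * N : ℕ) : ℝ))⁻¹ * (((Lc * N : ℕ) : ℝ))⁻¹) * ((((y α % ((Lc * N : ℕ) : ℤ) : ℤ) : ℝ) - ((((Lc * N : ℕ) : ℝ)) - 1) / 2)) else 0)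
        + (if b = α then (-(((Lc * N : ℕ) : ℝ))⁻¹ * ((((y μ % ((Lc * N : ℕ) : ℤ) : ℤ) : ℝ) - ((((Lc * N : ℕ) : ℝ)) - 1) / 2))) *
            (if y α % ((Lc * N : ℕ) : ℤ) = ((Lc * N : ℕ) : ℤ) - 1 then (1 : ℝ) else 0) else 0)))
    (qR := fun b' (s : Site (d + 1)) =>
      ((if b' = ν then ((((Lc * N : ℕ) : ℝ))⁻¹ * (((Lc * N : ℕ) : ℝ))⁻¹) * ((((s β % ((Lc * N : ℕ) : ℤ) : ℤ) : ℝ) - ((((Lc * N : ℕ) : ℝ)) - 1) / 2)) else 0)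
        + (if b' = β then (-(((Lc * N : ℕ) : ℝ))⁻¹ * ((((s ν % ((Lc * N : ℕ) : ℤ) : ℤ) : ℝ) - ((((Lc * N : ℕ) : ℝ)) - 1) / 2))) *
            (if s β % ((Lc * N : ℕ) : ℤ) = ((Lc * N : ℕ) : ℤ) - 1 then (1 : ℝ) else 0) else 0)))
    (QL := fun a (y : Site (d + 1)) =>
      ((if a = μ then (((N : ℝ))⁻¹ * ((N : ℝ))⁻¹) * ((((y α % (N : ℤ) : ℤ) : ℝ) - (((N : ℝ)) - 1) / 2)) else 0)
        + (if a = α then (-((N : ℝ))⁻¹ * ((((y μ % (N : ℤ) : ℤ) : ℝ) - (((N : ℝ)) - 1) / 2))) *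
            (if y α % (N : ℤ) = (N : ℤ) - 1 then (1 : ℝ) else 0) else 0)))
    (QR := fun b' (s : Site (d + 1)) =>
      ((if b' = ν then (((N : ℝ))⁻¹ * ((N : ℝ))⁻¹) * ((((s β % (N : ℤ) : ℤ) : ℝ) - (((N : ℝ)) - 1) / 2)) else 0)
        + (if b' = β then (-((N : ℝ))⁻¹ * ((((s ν % (N : ℤ) : ℤ) : ℝ) - (((N : ℝ)) - 1) / 2))) *
            (if s β % (N : ℤ) = (N : ℤ) - 1 then (1 : ℝ) else 0) else 0)))
    (B := 2)
    (fun b y t => (qProfileM_periodic' (d := d) (Lc * N) μ α b y t).symm) (fun b' s t => (qProfileM_periodic' (d := d) (Lc * N) ν β b' s t).symm)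
    (fun b y => abs_qProfileM_le_two (d := d) hM μ α b y) (fun b' s => abs_qProfileM_le_two (d := d) hM ν β b' s)
    (fun κ y => contourSum_qProfile_mul (Lc := Lc) hN hμα κ y) (fun κ y => contourSum_qProfile_mul (Lc := Lc) hN hνβ κ y)
  rw [← hval, Finset.mul_sum]
  refine Finset.sum_congr rfl fun x _ => ?_
  rw [Finset.mul_sum]
  refine Finset.sum_congr rfl fun a _ => ?_
  -- left current: the level-0 K1b∕K2 (first-leg form)
  rw [faceface_wilsonA_eq_E2zero_fst Lc hM hμα (toSite x) a]
  -- right current, pointwise in `(z, b)`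
  have hR : ∀ (z : Site (d + 1)) (b : Fin (d + 1)),
      (∑' w : Site (d + 1), (if w β % ((Lc * N : ℕ) : ℤ) = ((Lc * N : ℕ) : ℤ) - 1 then (1 : ℝ) else 0) *
        ∑' t : Site (d + 1), (if t ν % ((Lc * N : ℕ) : ℤ) = ((Lc * N : ℕ) : ℤ) - 1 then wilsonA d ν t z w (Sum.inl b) (Sum.inl β) else 0)) =
      (1 / 2 : ℝ) * ∑' s : Site (d + 1), ∑ b' : Fin (d + 1), E2 d Lc 0 z s (Sum.inl b) (Sum.inl b') *
        ((if b' = ν then ((((Lc * N : ℕ) : ℝ))⁻¹ * (((Lc * N : ℕ) : ℝ))⁻¹) * ((((s β % ((Lc * N : ℕ) : ℤ) : ℤ) : ℝ) - ((((Lc * N : ℕ) : ℝ)) - 1) / 2)) else 0)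
        + (if b' = β then (-(((Lc * N : ℕ) : ℝ))⁻¹ * ((((s ν % ((Lc * N : ℕ) : ℤ) : ℤ) : ℝ) - ((((Lc * N : ℕ) : ℝ)) - 1) / 2))) *
            (if s β % ((Lc * N : ℕ) : ℤ) = ((Lc * N : ℕ) : ℤ) - 1 then (1 : ℝ) else 0) else 0)) :=
    fun z b => faceface_wilsonA_eq_E2zero Lc hM hνβ z b
  simp_rw [hR]
  have hpull : ∀ (X B : Site (d + 1) → Fin (d + 1) → ℝ) (c : ℝ),
      (∑' z : Site (d + 1), ∑ b : Fin (d + 1), X z b * (c * B z b)) = c * ∑' z : Site (d + 1), ∑ b : Fin (d + 1), X z b * B z b := by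
    intro X B c
    rw [← tsum_mul_left]
    refine tsum_congr fun z => ?_
    rw [Finset.mul_sum]
    exact Finset.sum_congr rfl fun b _ => by ring
  rw [hpull]
  ring

/-! ## §2 The same for the unit-scaled level-`0` E-sector table `unitS sf sm (cE • wilsonA d)` -/

/-- [folklore] On field legs the unit-scaled, amplitude-weighted Wilson table is a scalar multiple of the raw one:
`unitS sf sm (cE • wilsonA d) κ t x z (inl a)(inl b) = ((sf·sm)⁻¹sf⁻²cE)·wilsonA d κ t x z (inl a)(inl b)`. -/
theorem unitS_smul_wilsonA_inl_inl (sf sm cE : ℝ) (κ : Fin (d + 1)) (t x z : Fin (d + 1) → ℤ) (a b : Fin (d + 1)) :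
    unitS sf sm (fun κ u => cE • wilsonA d κ u) κ t x z (Sum.inl a) (Sum.inl b) = ((sf * sm)⁻¹ * (sf⁻¹ * sf⁻¹) * cE) * wilsonA d κ t x z (Sum.inl a) (Sum.inl b) := by
  rw [unitS_apply]
  simp only [Pi.smul_apply, smul_eq_mul, legScale_inl]
  ring

/-- [folklore] The scalar passes through a face-gated slot sum and its leg weight (Wilson table):
`Σ'_w W w·Σ'_t (if P t then unitS sf sm (cE • wilsonA d) κ t z w (inl b)(inl e) else 0) = ((sf·sm)⁻¹sf⁻²cE)·Σ'_w W w·Σ'_t (if P t then wilsonA d κ t z w (inl b)(inl e) else 0)`. -/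
theorem faceface_unitS_smul_wilsonA (sf sm cE : ℝ) (κ : Fin (d + 1)) (P : (Fin (d + 1) → ℤ) → Prop) [DecidablePred P] (W : (Fin (d + 1) → ℤ) → ℝ)
    (zOf wOf : (Fin (d + 1) → ℤ) → (Fin (d + 1) → ℤ)) (b e : Fin (d + 1)) :
    (∑' w : Fin (d + 1) → ℤ, W w * ∑' t : Fin (d + 1) → ℤ, (if P t then unitS sf sm (fun κ u => cE • wilsonA d κ u) κ t (zOf w) (wOf w) (Sum.inl b) (Sum.inl e) else 0)) =
      ((sf * sm)⁻¹ * (sf⁻¹ * sf⁻¹) * cE) *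
        ∑' w : Fin (d + 1) → ℤ, W w * ∑' t : Fin (d + 1) → ℤ, (if P t then wilsonA d κ t (zOf w) (wOf w) (Sum.inl b) (Sum.inl e) else 0) := by
  have hin : ∀ w : Fin (d + 1) → ℤ, (∑' t : Fin (d + 1) → ℤ, (if P t then unitS sf sm (fun κ u => cE • wilsonA d κ u) κ t (zOf w) (wOf w) (Sum.inl b) (Sum.inl e) else 0)) =
      ((sf * sm)⁻¹ * (sf⁻¹ * sf⁻¹) * cE) * ∑' t : Fin (d + 1) → ℤ, (if P t then wilsonA d κ t (zOf w) (wOf w) (Sum.inl b) (Sum.inl e) else 0) := by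
    intro w
    rw [← tsum_mul_left]
    refine tsum_congr fun t => ?_
    split_ifs
    · exact unitS_smul_wilsonA_inl_inl sf sm cE κ t (zOf w) (wOf w) b e
    · exact (mul_zero _).symm
  simp_rw [hin]
  rw [← tsum_mul_left]
  exact tsum_congr fun w => by ring

/-- NOT IN PRINT; OUR BOOKKEEPING.  **THE SAME VALUE FOR road-P2's UNIT-SCALED LEVEL-`0` E-SECTOR TABLE `S^E_0 = unitS sf sm (cE • wilsonA d)`** (`μ ≠ α`, `ν ≠ β`): the two currents
each carry the factor `K_E = (sf·sm)⁻¹·sf⁻²·cE`, so the cell pairing of §1 with `S^E_0` in place of `wilsonA d` equals `K_E²` times §1's value. -/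
theorem cellPairing_zero_value_units (hr : r ∈ box (d + 1) Lc) (sf sm cE : ℝ) (N : ℕ) [NeZero N] {μ α ν β : Fin (d + 1)} (hμα : μ ≠ α) (hνβ : ν ≠ β) :
    ∑ x ∈ box (d + 1) (Lc * N), ∑ a : Fin (d + 1),
        (∑' y : Site (d + 1), (if y α % ((Lc * N : ℕ) : ℤ) = ((Lc * N : ℕ) : ℤ) - 1 then (1 : ℝ) else 0) *
          ∑' t : Site (d + 1), (if t μ % ((Lc * N : ℕ) : ℤ) = ((Lc * N : ℕ) : ℤ) - 1 then
            unitS sf sm (fun κ u => cE • wilsonA d κ u) μ t y (toSite x) (Sum.inl α) (Sum.inl a)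
            else 0)) *
        (∑' z : Site (d + 1), ∑ b : Fin (d + 1), unitK sf sm (coDressKBmAt (toSite r) Lc (KInvStep (d := d) Lc 0)) (toSite x) z (Sum.inl a) (Sum.inl b) *
          (∑' w : Site (d + 1), (if w β % ((Lc * N : ℕ) : ℤ) = ((Lc * N : ℕ) : ℤ) - 1 then (1 : ℝ) else 0) *
            ∑' t : Site (d + 1), (if t ν % ((Lc * N : ℕ) : ℤ) = ((Lc * N : ℕ) : ℤ) - 1 then
              unitS sf sm (fun κ u => cE • wilsonA d κ u) ν t z w (Sum.inl b) (Sum.inl β)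
              else 0))) =
      (((sf * sm)⁻¹ * (sf⁻¹ * sf⁻¹) * cE) * ((sf * sm)⁻¹ * (sf⁻¹ * sf⁻¹) * cE)) *
      ((-(1 / 2 : ℝ)) * (1 / 2 : ℝ) * ((sf * sf) *
        ((wVH d Lc 0)⁻¹ *
            ∑ x ∈ box (d + 1) (Lc * N), ∑ b : Fin (d + 1),
              ((if b = μ then ((((Lc * N : ℕ) : ℝ))⁻¹ * (((Lc * N : ℕ) : ℝ))⁻¹) * ((((toSite x α % ((Lc * N : ℕ) : ℤ) : ℤ) : ℝ) - ((((Lc * N : ℕ) : ℝ)) - 1) / 2)) else 0)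
                + (if b = α then (-(((Lc * N : ℕ) : ℝ))⁻¹ * ((((toSite x μ % ((Lc * N : ℕ) : ℤ) : ℤ) : ℝ) - ((((Lc * N : ℕ) : ℝ)) - 1) / 2))) *
                    (if toSite x α % ((Lc * N : ℕ) : ℤ) = ((Lc * N : ℕ) : ℤ) - 1 then (1 : ℝ) else 0) else 0)) *
              ∑' s : Site (d + 1), ∑ b' : Fin (d + 1), E2 d Lc 0 (toSite x) s (Sum.inl b) (Sum.inl b') *
                ((if b' = ν then ((((Lc * N : ℕ) : ℝ))⁻¹ * (((Lc * N : ℕ) : ℝ))⁻¹) * ((((s β % ((Lc * N : ℕ) : ℤ) : ℤ) : ℝ) - ((((Lc * N : ℕ) : ℝ)) - 1) / 2)) else 0)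
                  + (if b' = β then (-(((Lc * N : ℕ) : ℝ))⁻¹ * ((((s ν % ((Lc * N : ℕ) : ℤ) : ℤ) : ℝ) - ((((Lc * N : ℕ) : ℝ)) - 1) / 2))) *
                      (if s β % ((Lc * N : ℕ) : ℤ) = ((Lc * N : ℕ) : ℤ) - 1 then (1 : ℝ) else 0) else 0)) -
          (wVH d Lc 0)⁻¹ * (((Lc : ℝ) ^ (d + 1) * (Lc : ℝ) ^ (d + 1)) *
            ∑ y ∈ box (d + 1) N, ∑ a : Fin (d + 1),
              ((if a = μ then (((N : ℝ))⁻¹ * ((N : ℝ))⁻¹) * ((((toSite y α % (N : ℤ)) : ℤ) : ℝ) - ((N : ℝ) - 1) / 2) else 0)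
                + (if a = α then (-((N : ℝ))⁻¹ * ((((toSite y μ % (N : ℤ)) : ℤ) : ℝ) - ((N : ℝ) - 1) / 2)) *
                    (if toSite y α % (N : ℤ) = (N : ℤ) - 1 then (1 : ℝ) else 0) else 0)) *
              ∑' s : Site (d + 1), ∑ b' : Fin (d + 1), E2 d Lc 1 (toSite y) s (Sum.inl a) (Sum.inl b') *
                ((if b' = ν then (((N : ℝ))⁻¹ * ((N : ℝ))⁻¹) * ((((s β % (N : ℤ)) : ℤ) : ℝ) - ((N : ℝ) - 1) / 2) else 0)
                  + (if b' = β then (-((N : ℝ))⁻¹ * ((((s ν % (N : ℤ)) : ℤ) : ℝ) - ((N : ℝ) - 1) / 2)) *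
                      (if s β % (N : ℤ) = (N : ℤ) - 1 then (1 : ℝ) else 0) else 0)))))) := by
  rw [← cellPairing_zero_value hr sf sm N hμα hνβ, Finset.mul_sum]
  refine Finset.sum_congr rfl fun x _ => ?_
  rw [Finset.mul_sum]
  refine Finset.sum_congr rfl fun a _ => ?_
  -- units out of the left current
  rw [faceface_unitS_smul_wilsonA sf sm cE μ (fun t : Site (d + 1) => t μ % ((Lc * N : ℕ) : ℤ) = ((Lc * N : ℕ) : ℤ) - 1)
      (fun y : Site (d + 1) => (if y α % ((Lc * N : ℕ) : ℤ) = ((Lc * N : ℕ) : ℤ) - 1 then (1 : ℝ) else 0)) (fun y => y) (fun _ => toSite x) α a]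
  -- units out of the right current, pointwise in `(z, b)`
  have hR : ∀ (z : Site (d + 1)) (b : Fin (d + 1)),
      (∑' w : Site (d + 1), (if w β % ((Lc * N : ℕ) : ℤ) = ((Lc * N : ℕ) : ℤ) - 1 then (1 : ℝ) else 0) *
        ∑' t : Site (d + 1), (if t ν % ((Lc * N : ℕ) : ℤ) = ((Lc * N : ℕ) : ℤ) - 1 then
          unitS sf sm (fun κ u => cE • wilsonA d κ u) ν t z w (Sum.inl b) (Sum.inl β) else 0)) =
      ((sf * sm)⁻¹ * (sf⁻¹ * sf⁻¹) * cE) *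
        (∑' w : Site (d + 1), (if w β % ((Lc * N : ℕ) : ℤ) = ((Lc * N : ℕ) : ℤ) - 1 then (1 : ℝ) else 0) *
          ∑' t : Site (d + 1), (if t ν % ((Lc * N : ℕ) : ℤ) = ((Lc * N : ℕ) : ℤ) - 1 then wilsonA d ν t z w (Sum.inl b) (Sum.inl β) else 0)) :=
    fun z b => faceface_unitS_smul_wilsonA sf sm cE ν (fun t : Site (d + 1) => t ν % ((Lc * N : ℕ) : ℤ) = ((Lc * N : ℕ) : ℤ) - 1)
      (fun w : Site (d + 1) => (if w β % ((Lc * N : ℕ) : ℤ) = ((Lc * N : ℕ) : ℤ) - 1 then (1 : ℝ) else 0)) (fun _ => z) (fun w => w) b β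
  simp_rw [hR]
  have hpull : ∀ (X B : Site (d + 1) → Fin (d + 1) → ℝ) (c : ℝ),
      (∑' z : Site (d + 1), ∑ b : Fin (d + 1), X z b * (c * B z b)) = c * ∑' z : Site (d + 1), ∑ b : Fin (d + 1), X z b * B z b := by
    intro X B c
    rw [← tsum_mul_left]
    refine tsum_congr fun z => ?_
    rw [Finset.mul_sum]
    exact Finset.sum_congr rfl fun b _ => by ring
  rw [hpull]
  ring

end Summit.QuantumFields.BalabanUV.Beta.GAN24.FaceWordEEValueZero

end
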